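import Summits.RiemannHypothesis.RiemannHypothesis.Theorems.Splittings.RobinFiniteE3Window
import HarnessLib

/-!
# RobinFiniteE3Large2Window — Part 2/5 — the θ-window at relative error `ε(2³⁰) = 0.00053` and the two-piece layer cake
(`schoenfeld_rel_le_00053`, `theta_ge_99947W`, `theta_le_100053W`, `log_2e19_gt`, `logP_ge19`, `sqrtP_ge19`,
`P_ge_2e10_of19`, `bracket0_ge`, `bracket1_ge`, `window_bound2W`).

The E3 large branch (`RobinFiniteE3Large.G_largeW`) bounds `S = Σ_{Q<p≤P} p⁻²` through ONE layer cake over `(y, 20y]`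
with the window's relative error `ε(2¹⁵) = 0.025`.  For `P ≥ 2·10¹⁹` every θ-point used is `≥ 2³⁰`, where
`√t log² t/(8π) ≤ 0.00053·t`, and a second piece `(20y, 400y]` fits below `P` (`400·6√P ≤ P`):
`window_bound2W : (0.9009/log(20y) + 0.09244/log(400y))/y ≤ S` for `2³⁰ ≤ y`, `400y ≤ P ≤ B`, `Q ≤ y`.
Same shapes and the same `RobinAnalytic` layer-cake lemmas as `RobinFiniteE3Large.window_boundW`; constants only.

Cell rh-split, seat rh-split-robin-finite g8 (brief sha16 f79c5f09d8bcb036), card `cards/SPLIT-robin-finite.md` §15;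
carved from the kernel-checked object `HOME/rh-split-robin-finite/g8/SketchG8-G.lean` (sha16 b720eb98042decc0, rc 0,
0 warnings, 0 sorries, axioms [propext, Classical.choice, Quot.sound]).  Zero `def`, zero `instance`, zero `notation`,
no attribute changes, no `native_decide`.

HONEST LABEL: SPLITTING SEARCH over kernel-typed RH-EQUIVALENCES; a splitting A ∧ B ⟹ RH is CONDITIONAL
bookkeeping unless A and B are both proved; nothing here bears on the truth of RH.
-/

set_option linter.dupNamespace false

noncomputable section

open Real Filter Finset
open scoped Chebyshev

namespace Summit.RiemannHypothesis.RiemannHypothesis.Theorems.Splittings.RobinFiniteE3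

open Literature.NumberTheory.LFunctions Literature.NumberTheory.DiophantineGeometry
open RobinAnalyticSharp

section LargeP2
open RobinAnalytic

/-- `√t log² t/(8π) ≤ 0.00053 t` for `t ≥ 2³⁰` (`log 2³⁰ ≤ 20.7945`, `√2³⁰ = 2¹⁵`, `20.7945²/2¹⁵ ≤ 0.013197`,
`0.013197 ≤ 0.00053·8·3.14`). -/
theorem schoenfeld_rel_le_00053 {t : ℝ} (ht : (2 : ℝ) ^ 30 ≤ t) :
    √t * Real.log t ^ 2 / (8 * π) ≤ 0.00053 * t := by
  have ht0 : 0 < t := lt_of_lt_of_le (by norm_num) ht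
  have h30 : Real.exp 4 ≤ (2 : ℝ) ^ 30 := exp_four_le.trans (by norm_num)
  have hmono := log_sq_div_sqrt_antitone h30 ht
  have hlog : Real.log ((2 : ℝ) ^ 30) ≤ 20.7945 := by
    rw [Real.log_pow]
    have := Real.log_two_lt_d9
    push_cast
    linarith
  have hlog0 : 0 ≤ Real.log ((2 : ℝ) ^ 30) := by
    rw [Real.log_pow]; have := Real.log_two_gt_d9; push_cast; positivity
  have hsq : √((2 : ℝ) ^ 30) = 2 ^ 15 := by
    rw [show ((2 : ℝ) ^ 30) = (2 ^ 15) ^ 2 by norm_num, Real.sqrt_sq (by norm_num)]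
  have hval : Real.log ((2 : ℝ) ^ 30) ^ 2 / √((2 : ℝ) ^ 30) ≤ 0.013197 := by
    rw [hsq, div_le_iff₀ (by positivity)]
    calc Real.log ((2 : ℝ) ^ 30) ^ 2 ≤ (20.7945 : ℝ) ^ 2 := by gcongr
      _ ≤ 0.013197 * 2 ^ 15 := by norm_num
  have hpi : (3.14 : ℝ) < π := Real.pi_gt_d2
  have hst : 0 < √t := Real.sqrt_pos.2 ht0
  have hid : √t * Real.log t ^ 2 = t * (Real.log t ^ 2 / √t) := by
    field_simp
    rw [Real.sq_sqrt ht0.le]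
    ring
  rw [hid, div_le_iff₀ (by positivity)]
  have hφ : Real.log t ^ 2 / √t ≤ 0.013197 := hmono.trans hval
  nlinarith

/-- `θ(t) ≥ 0.99947 t` for `2³⁰ ≤ t ≤ B` on the window. -/
theorem theta_ge_99947W {B t : ℝ} (hW : (∀ y : ℝ, 599 ≤ y → y ≤ B → |θ y - y| ≤ √y * Real.log y ^ 2 / (8 * π)))
    (ht : (2 : ℝ) ^ 30 ≤ t) (htB : t ≤ B) : 0.99947 * t ≤ θ t := by
  have h599 : (599 : ℝ) ≤ t := le_trans (by norm_num) ht
  have h1 := hW t h599 htB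
  have h2 := schoenfeld_rel_le_00053 ht
  have := (abs_le.1 h1).1
  linarith

/-- `θ(t) ≤ 1.00053 t` for `2³⁰ ≤ t ≤ B` on the window. -/
theorem theta_le_100053W {B t : ℝ} (hW : (∀ y : ℝ, 599 ≤ y → y ≤ B → |θ y - y| ≤ √y * Real.log y ^ 2 / (8 * π)))
    (ht : (2 : ℝ) ^ 30 ≤ t) (htB : t ≤ B) : θ t ≤ 1.00053 * t := by
  have h599 : (599 : ℝ) ≤ t := le_trans (by norm_num) ht
  have h1 := hW t h599 htB
  have h2 := schoenfeld_rel_le_00053 ht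
  have := (abs_le.1 h1).2
  linarith

/-- `log (2·10¹⁹) > 44.442`. -/
theorem log_2e19_gt : (44.442 : ℝ) < Real.log (2 * 10 ^ 19) := by
  rw [Real.log_mul (by norm_num) (by norm_num), Real.log_pow]
  have h2 := Real.log_two_gt_d9
  have h10 := log_ten_gt
  push_cast
  linarith

/-- `log P ≥ 44.442` for `P ≥ 2·10¹⁹`. -/
theorem logP_ge19 {P : ℕ} (hP : (2 * 10 ^ 19 : ℝ) ≤ P) : (44.442 : ℝ) ≤ Real.log P :=
  log_2e19_gt.le.trans (Real.log_le_log (by norm_num) hP)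

/-- `√P ≥ 4472135954` for `P ≥ 2·10¹⁹`. -/
theorem sqrtP_ge19 {P : ℕ} (hP : (2 * 10 ^ 19 : ℝ) ≤ P) : (4472135954 : ℝ) ≤ √(P : ℝ) :=
  (Real.le_sqrt_of_sq_le (by norm_num : (4472135954 : ℝ) ^ 2 ≤ 2 * 10 ^ 19)).trans (Real.sqrt_le_sqrt hP)

/-- `P ≥ 2·10¹⁰` for `P ≥ 2·10¹⁹`. -/
theorem P_ge_2e10_of19 {P : ℕ} (hP : (2 * 10 ^ 19 : ℝ) ≤ P) : (2 * 10 ^ 10 : ℝ) ≤ P := le_trans (by norm_num) hP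

/-- Piece-0 bracket (`y ≥ 2³⁰`):
`0.9009/y ≤ 0.99947 (2/(y+2) − 2/(20y+2)) − 1.00053 y (1/((y+1)(y+2)) − 1/((20y+1)(20y+2)))`. -/
theorem bracket0_ge {y : ℝ} (hy : (2 : ℝ) ^ 30 ≤ y) :
    0.9009 / y ≤ 0.99947 * (2 / (y + 2) - 2 / (20 * y + 2)) -
      1.00053 * y * (1 / ((y + 1) * (y + 2)) - 1 / ((20 * y + 1) * (20 * y + 2))) := by
  have hy' : (1073741824 : ℝ) ≤ y := le_trans (by norm_num) hy
  have hy0 : 0 < y := by linarith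
  have hA : 2 * 0.99999999 / y ≤ 2 / (y + 2) := by
    rw [div_le_div_iff₀ (by positivity) (by positivity)]
    nlinarith
  have hB : 2 / (20 * y + 2) ≤ 0.1 / y := by
    rw [div_le_div_iff₀ (by positivity) (by positivity)]
    nlinarith
  have hC : y * (1 / ((y + 1) * (y + 2))) ≤ 1 / y := by
    rw [mul_one_div, div_le_div_iff₀ (by positivity) (by positivity)]
    nlinarith
  have hD : 0.0025 * 0.99999999 / y ≤ y * (1 / ((20 * y + 1) * (20 * y + 2))) := by
    rw [mul_one_div, div_le_div_iff₀ (by positivity) (by positivity)]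
    nlinarith
  have hE : 0.9009 / y ≤ (0.99947 * (2 * 0.99999999) - 0.99947 * 0.1 - 1.00053 +
      1.00053 * (0.0025 * 0.99999999)) / y :=
    div_le_div_of_nonneg_right (by norm_num) hy0.le
  have hE' : (0.99947 * (2 * 0.99999999) - 0.99947 * 0.1 - 1.00053 + 1.00053 * (0.0025 * 0.99999999)) / y =
      0.99947 * (2 * 0.99999999 / y) - 0.99947 * (0.1 / y) - 1.00053 * (1 / y) +
        1.00053 * (0.0025 * 0.99999999 / y) := by ring
  rw [hE'] at hE
  calc 0.9009 / y ≤ _ := hE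
    _ ≤ 0.99947 * (2 / (y + 2)) - 0.99947 * (2 / (20 * y + 2)) -
        1.00053 * (y * (1 / ((y + 1) * (y + 2)))) + 1.00053 * (y * (1 / ((20 * y + 1) * (20 * y + 2)))) := by
        linarith
    _ = _ := by ring

/-- Piece-1 bracket (`y ≥ 2³⁰`):
`0.09244/y ≤ 0.99947 (2/(20y+2) − 2/(400y+2)) − 1.00053 y (1/((20y+1)(20y+2)) − 1/((400y+1)(400y+2)))`. -/
theorem bracket1_ge {y : ℝ} (hy : (2 : ℝ) ^ 30 ≤ y) :
    0.09244 / y ≤ 0.99947 * (2 / (20 * y + 2) - 2 / (400 * y + 2)) -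
      1.00053 * y * (1 / ((20 * y + 1) * (20 * y + 2)) - 1 / ((400 * y + 1) * (400 * y + 2))) := by
  have hy' : (1073741824 : ℝ) ≤ y := le_trans (by norm_num) hy
  have hy0 : 0 < y := by linarith
  have hA : 0.1 * 0.99999999 / y ≤ 2 / (20 * y + 2) := by
    rw [div_le_div_iff₀ (by positivity) (by positivity)]
    nlinarith
  have hB : 2 / (400 * y + 2) ≤ 0.005 / y := by
    rw [div_le_div_iff₀ (by positivity) (by positivity)]
    nlinarith
  have hC : y * (1 / ((20 * y + 1) * (20 * y + 2))) ≤ 0.0025 / y := by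
    rw [mul_one_div, div_le_div_iff₀ (by positivity) (by positivity)]
    nlinarith
  have hD : 0 ≤ y * (1 / ((400 * y + 1) * (400 * y + 2))) := by positivity
  have hE : 0.09244 / y ≤ (0.99947 * (0.1 * 0.99999999) - 0.99947 * 0.005 - 1.00053 * 0.0025) / y :=
    div_le_div_of_nonneg_right (by norm_num) hy0.le
  have hE' : (0.99947 * (0.1 * 0.99999999) - 0.99947 * 0.005 - 1.00053 * 0.0025) / y =
      0.99947 * (0.1 * 0.99999999 / y) - 0.99947 * (0.005 / y) - 1.00053 * (0.0025 / y) := by ring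
  rw [hE'] at hE
  calc 0.09244 / y ≤ _ := hE
    _ ≤ 0.99947 * (2 / (20 * y + 2)) - 0.99947 * (2 / (400 * y + 2)) -
        1.00053 * (y * (1 / ((20 * y + 1) * (20 * y + 2)))) +
          1.00053 * (y * (1 / ((400 * y + 1) * (400 * y + 2)))) := by
        linarith
    _ = _ := by ring

/-- **Two-piece window bound.** On the window, for a natural `y ≥ 2³⁰` with `400 y ≤ P ≤ B` and `Q ≤ y`:
`∑_{Q < p ≤ P} 1/p² ≥ (0.9009/log(20y) + 0.09244/log(400y))/y` (layer cake over `(y, 400y]`, the count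
`#{y < p ≤ n} ≥ (0.99947 n − 1.00053 y)/log T` with `T = 20y` on `(y, 20y]` and `T = 400y` on `(20y, 400y]`). -/
theorem window_bound2W {B : ℝ} (hW : (∀ y : ℝ, 599 ≤ y → y ≤ B → |θ y - y| ≤ √y * Real.log y ^ 2 / (8 * π)))
    {y P Q : ℕ} (hy : (2 : ℝ) ^ 30 ≤ y) (hyP : 400 * y ≤ P) (hPB : (P : ℝ) ≤ B) (hQy : Q ≤ y) :
    (0.9009 / Real.log (20 * y) + 0.09244 / Real.log (400 * y)) / y ≤
      ∑ p ∈ (Nat.primesLE P).filter (fun p => Q < p), ((p : ℝ) ^ 2)⁻¹ := by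
  classical
  have hy1R : (1073741824 : ℝ) ≤ y := le_trans (by norm_num) hy
  have hy1 : 1073741824 ≤ y := by exact_mod_cast hy1R
  have hy0 : (0 : ℝ) < y := by linarith
  set z := 400 * y with hz
  set m := 20 * y with hm
  have hym : y ≤ m := by omega
  have hmz : m ≤ z := by omega
  have hyz : y ≤ z := by omega
  -- restrict to the primes in `(y, z]`
  have hsub : (Nat.primesLE z).filter (fun p => y < p) ⊆ (Nat.primesLE P).filter (fun p => Q < p) := by
    intro p hp
    obtain ⟨hp1, hyp⟩ := Finset.mem_filter.1 hp
    obtain ⟨hpz, hp'⟩ := Nat.mem_primesLE.1 hp1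
    exact Finset.mem_filter.2 ⟨Nat.mem_primesLE.2 ⟨hpz.trans hyP, hp'⟩, lt_of_le_of_lt hQy hyp⟩
  refine le_trans ?_ (Finset.sum_le_sum_of_subset_of_nonneg hsub fun p _ _ => by positivity)
  refine le_trans ?_ (layer_cake y z)
  -- pointwise: `#{y < p ≤ n} ≥ (0.99947 n − 1.00053 y)/log T` for `n ≤ T`
  have hcount : ∀ n ∈ Ioc y z, ∀ T : ℝ, (n : ℝ) ≤ T →
      (0.99947 * n - 1.00053 * y) / Real.log T ≤ #((Nat.primesLE n).filter (fun p => y < p)) := by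
    intro n hn T hnT
    rw [Finset.mem_Ioc] at hn
    have hnR : (y : ℝ) + 1 ≤ n := by exact_mod_cast hn.1
    have hn30 : (2 : ℝ) ^ 30 ≤ n := by linarith
    have h1 := theta_sub_theta_le_card_mul_log y n
    have hnB : (n : ℝ) ≤ B := le_trans (by exact_mod_cast hn.2.trans hyP) hPB
    have hyB : (y : ℝ) ≤ B := le_trans (by exact_mod_cast hyz.trans hyP) hPB
    have h2 := theta_ge_99947W hW hn30 hnB
    have h3 := theta_le_100053W hW hy hyB
    have hlogn : 0 < Real.log n := Real.log_pos (by linarith)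
    have hlogT : Real.log n ≤ Real.log T := Real.log_le_log (by linarith) hnT
    have hlogT0 : 0 < Real.log T := lt_of_lt_of_le hlogn hlogT
    set c : ℝ := (#((Nat.primesLE n).filter (fun p => y < p)) : ℝ) with hc
    have hc0 : 0 ≤ c := by positivity
    by_cases hneg : (0.99947 : ℝ) * n - 1.00053 * y ≤ 0
    · exact le_trans (div_nonpos_of_nonpos_of_nonneg hneg hlogT0.le) hc0
    rw [not_le] at hneg
    rw [div_le_iff₀ hlogT0]
    calc 0.99947 * n - 1.00053 * y ≤ θ n - θ y := by linarith
      _ ≤ c * Real.log n := h1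
      _ ≤ c * Real.log T := by gcongr
  have hd0 : ∀ n ∈ Ioc y z, 0 ≤ (1 / ((n : ℝ) * (n + 1)) - 1 / (((n : ℝ) + 1) * (n + 2))) := by
    intro n hn
    rw [Finset.mem_Ioc] at hn
    rw [weight_eq n (by omega)]
    positivity
  have hlogm : 0 < Real.log (20 * y) := Real.log_pos (by linarith)
  have hlogzz : 0 < Real.log (400 * y) := Real.log_pos (by linarith)
  -- piece 0: `(y, 20y]` with `T = 20y`
  have hpiece0 : 0.9009 / y / Real.log (20 * y) ≤
      ∑ n ∈ Ioc y m, (1 / ((n : ℝ) * (n + 1)) - 1 / (((n : ℝ) + 1) * (n + 2))) *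
        #((Nat.primesLE n).filter (fun p => y < p)) := by
    calc 0.9009 / y / Real.log (20 * y)
        ≤ ∑ n ∈ Ioc y m, (1 / ((n : ℝ) * (n + 1)) - 1 / (((n : ℝ) + 1) * (n + 2))) *
            ((0.99947 * n - 1.00053 * y) / Real.log (20 * y)) := by
          have hsum : ∑ n ∈ Ioc y m, (1 / ((n : ℝ) * (n + 1)) - 1 / (((n : ℝ) + 1) * (n + 2))) *
              ((0.99947 * n - 1.00053 * y) / Real.log (20 * y)) =
              (0.99947 * (2 / ((y : ℝ) + 2) - 2 / ((m : ℝ) + 2)) -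
                1.00053 * y * (1 / (((y : ℝ) + 1) * (y + 2)) - 1 / (((m : ℝ) + 1) * (m + 2)))) /
                Real.log (20 * y) := by
            rw [← sum_mul_weight hym, ← sum_weight hym, Finset.mul_sum, Finset.mul_sum,
              ← Finset.sum_sub_distrib, Finset.sum_div]
            refine Finset.sum_congr rfl fun n _ => ?_
            ring
          rw [hsum, hm]
          push_cast
          exact div_le_div_of_nonneg_right (bracket0_ge hy) hlogm.le
      _ ≤ _ := by
          refine Finset.sum_le_sum fun n hn => ?_
          have hn' : n ∈ Ioc y z := by
            rw [Finset.mem_Ioc] at hn ⊢; exact ⟨hn.1, hn.2.trans hmz⟩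
          have hnT : (n : ℝ) ≤ 20 * y := by
            rw [Finset.mem_Ioc] at hn; exact_mod_cast hn.2
          exact mul_le_mul_of_nonneg_left (hcount n hn' _ hnT) (hd0 n hn')
  -- piece 1: `(20y, 400y]` with `T = 400y`
  have hpiece1 : 0.09244 / y / Real.log (400 * y) ≤
      ∑ n ∈ Ioc m z, (1 / ((n : ℝ) * (n + 1)) - 1 / (((n : ℝ) + 1) * (n + 2))) *
        #((Nat.primesLE n).filter (fun p => y < p)) := by
    calc 0.09244 / y / Real.log (400 * y)
        ≤ ∑ n ∈ Ioc m z, (1 / ((n : ℝ) * (n + 1)) - 1 / (((n : ℝ) + 1) * (n + 2))) *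
            ((0.99947 * n - 1.00053 * y) / Real.log (400 * y)) := by
          have hsum : ∑ n ∈ Ioc m z, (1 / ((n : ℝ) * (n + 1)) - 1 / (((n : ℝ) + 1) * (n + 2))) *
              ((0.99947 * n - 1.00053 * y) / Real.log (400 * y)) =
              (0.99947 * (2 / ((m : ℝ) + 2) - 2 / ((z : ℝ) + 2)) -
                1.00053 * y * (1 / (((m : ℝ) + 1) * (m + 2)) - 1 / (((z : ℝ) + 1) * (z + 2)))) /
                Real.log (400 * y) := by
            rw [← sum_mul_weight hmz, ← sum_weight hmz, Finset.mul_sum, Finset.mul_sum,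
              ← Finset.sum_sub_distrib, Finset.sum_div]
            refine Finset.sum_congr rfl fun n _ => ?_
            ring
          rw [hsum, hm, hz]
          push_cast
          exact div_le_div_of_nonneg_right (bracket1_ge hy) hlogzz.le
      _ ≤ _ := by
          refine Finset.sum_le_sum fun n hn => ?_
          have hn' : n ∈ Ioc y z := by
            rw [Finset.mem_Ioc] at hn ⊢; exact ⟨lt_of_le_of_lt hym hn.1, hn.2⟩
          have hnT : (n : ℝ) ≤ 400 * y := by
            rw [Finset.mem_Ioc] at hn; exact_mod_cast hn.2
          exact mul_le_mul_of_nonneg_left (hcount n hn' _ hnT) (hd0 n hn')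
  rw [← Finset.sum_Ioc_consecutive _ hym hmz]
  have e : (0.9009 / Real.log (20 * y) + 0.09244 / Real.log (400 * y)) / y =
      0.9009 / y / Real.log (20 * y) + 0.09244 / y / Real.log (400 * y) := by
    field_simp
  rw [e]
  exact add_le_add hpiece0 hpiece1

end LargeP2

end Summit.RiemannHypothesis.RiemannHypothesis.Theorems.Splittings.RobinFiniteE3
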